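import Mathlib
import HarnessLib
import Literature.MathematicalPhysics.QuantumLattice.SchwartzOrderedWedgeDensity
import Literature.MathematicalPhysics.QuantumFieldTheory.MassGapFromLatticeClustering
import Literature.MathematicalPhysics.QuantumLattice.SchwartzHalfSpaceCutoffC
import Literature.Analysis.Distribution.SchwartzMultipliers

/-!
# Ordered-wedge density with coordinate-bounded factors

Glue for the line `Sketch` of the crux `ContinuumLegGivenGap` (stub `stub_bddSlabDensity`): every
time-ordered `n`-point test function `F` on `((ℝ⁴)ⁿ)` (`IsTimeOrdered`) lies in the closure, for the
Schwartz topology, of the `ℂ`-span of the real product tensors `⊗ₗ pₗ` (`IsTensorOf`, factors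
complexified by `ofRealTest`) whose factor data are slab-ordered in time (`IsSlabOrdered`) AND
supported in a bounded range `{|xⁱ| ≤ ρ}` of a fixed coordinate `i : Fin 4`.

Route. The tree's ordered-wedge density `IsTimeOrdered.mem_closure_span_slabOrderedProducts`
(`SchwartzOrderedWedgeDensity`) puts `F` in the closure of the span of ALL slab-ordered real product
tensors `P = ⊗ₗ fₗ` (`slabOrderedProducts 4 n`), so it suffices that each such `P` lies in the closed
span of the bounded ones. The two-sided coordinate cut-offs `cutLE i ρ (cutGE i (-ρ) P)`
(`SchwartzHalfSpaceCutoff`) converge to `P` in `𝓢` as `ρ → ∞` (`tendsto_cutLE_atTop`,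
`tendsto_cutGE_atBot` and the `θ`-uniform seminorm bounds `exists_bound_seminorm_cutLE` of
`SchwartzHalfSpaceCutoffC`), and since the weights are products over the points
(`cutLE_apply`, `cutGE_apply`), each cut-off is again a real product tensor: that of the factors
`fₗ` multiplied by the one-point smooth steps `y ↦ σ(ρ + 1 - yⁱ) σ(yⁱ + ρ + 1)`
(`σ = Real.smoothTransition`, of temperate growth by the tree's `hasTemperateGrowth_smoothTransition`
of `Literature.Analysis.Distribution.SchwartzMultipliers`; `SchwartzMap.smulLeftCLM`), whose supports lie in
`supp fₗ ∩ {|yⁱ| ≤ ρ + 1}` — still slab-ordered, and `xⁱ`-bounded.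

References: textbook folklore (K. Osterwalder, R. Schrader, CMP 31 (1973) §2: the spaces `𝒮_<`,
`𝒮_±` and cut-offs on `𝒮`; L. Hörmander, ALPDO I §7.1). No definitions, no notation.
-/

noncomputable section

namespace Summit.QuantumFields.YangMills.Theorems.ContinuumLegGivenGap

open Filter Topology Set
open scoped SchwartzMap
open Literature.MathematicalPhysics.QuantumFieldTheory Literature.MathematicalPhysics.QuantumLattice
  Literature.MathematicalPhysics.AQFT
open Literature.Analysis.Distribution (hasTemperateGrowth_smoothTransition)

/-! ### The one-point two-sided weight -/

/-- The one-point two-sided smooth cut-off weight in the coordinate `i`,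
`y ↦ σ(ρ + 1 - yⁱ) σ(yⁱ - (-ρ) + 1)`, has temperate growth. [folklore] -/
theorem hasTemperateGrowth_bddWeight (i : Fin 4) (ρ : ℝ) :
    (fun y : EuclideanSpace ℝ (Fin 4) =>
      Real.smoothTransition (ρ + 1 - y i) * Real.smoothTransition (y i - -ρ + 1)).HasTemperateGrowth := by
  have hc : (fun y : EuclideanSpace ℝ (Fin 4) => y i).HasTemperateGrowth :=
    (EuclideanSpace.proj (𝕜 := ℝ) i).hasTemperateGrowth
  have h1 : (fun y : EuclideanSpace ℝ (Fin 4) => Real.smoothTransition (ρ + 1 - y i)).HasTemperateGrowth :=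
    hasTemperateGrowth_smoothTransition.comp ((Function.HasTemperateGrowth.const (ρ + 1)).sub hc)
  have h2 : (fun y : EuclideanSpace ℝ (Fin 4) => Real.smoothTransition (y i - -ρ + 1)).HasTemperateGrowth :=
    hasTemperateGrowth_smoothTransition.comp
      ((hc.sub (Function.HasTemperateGrowth.const (-ρ))).add (Function.HasTemperateGrowth.const 1))
  exact h1.mul h2

/-- The one-point two-sided weight `σ(ρ + 1 - yⁱ) σ(yⁱ - (-ρ) + 1)` vanishes where `|yⁱ| > ρ + 1`:
its topological support lies in `{|yⁱ| ≤ ρ + 1}`. [folklore] -/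
theorem tsupport_bddWeight_subset (i : Fin 4) (ρ : ℝ) :
    tsupport (fun y : EuclideanSpace ℝ (Fin 4) =>
        Real.smoothTransition (ρ + 1 - y i) * Real.smoothTransition (y i - -ρ + 1)) ⊆
      {y | |y i| ≤ ρ + 1} := by
  have hcl : IsClosed {y : EuclideanSpace ℝ (Fin 4) | |y i| ≤ ρ + 1} :=
    isClosed_le (continuous_abs.comp (EuclideanSpace.proj (𝕜 := ℝ) i).continuous) continuous_const
  refine closure_minimal (fun y hy => ?_) hcl
  rw [mem_setOf_eq, abs_le]
  by_contra h
  rw [not_and_or, not_le, not_le] at h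
  apply hy
  rcases h with h | h
  · exact mul_eq_zero_of_right _ (Real.smoothTransition.zero_of_nonpos (by linarith))
  · exact mul_eq_zero_of_left (Real.smoothTransition.zero_of_nonpos (by linarith)) _

/-! ### The two-sided coordinate cut-off of a slab-ordered real product tensor -/

/-- **The cut-off of a slab-ordered real product tensor is a slab-ordered real product tensor with
`xⁱ`-bounded factors.** If `P = ⊗ₗ fₗ` with slab-ordered real factor data `f`, then
`cutLE i ρ (cutGE i (-ρ) P) = ⊗ₗ pₗ` with `pₗ = σ(ρ + 1 - yⁱ) σ(yⁱ + ρ + 1) fₗ`: the data `p` is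
slab-ordered (same slabs) and `supp pₗ ⊆ {|yⁱ| ≤ ρ + 1}` (Osterwalder–Schrader 1973 §2). [folklore] -/
theorem exists_bdd_factors_cutLE_cutGE {n : ℕ} (i : Fin 4) (ρ : ℝ)
    {P : 𝓢((Fin n → EuclideanSpace ℝ (Fin 4)), ℂ)} {f : Fin n → 𝓢(EuclideanSpace ℝ (Fin 4), ℝ)}
    (hP : IsTensorOf P fun l => ofRealTest (f l)) (hf : IsSlabOrdered f) :
    ∃ (p : Fin n → 𝓢(EuclideanSpace ℝ (Fin 4), ℝ)) (ρ' : ℝ),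
      IsTensorOf (cutLE i ρ (cutGE i (-ρ) P)) (fun l => ofRealTest (p l)) ∧ IsSlabOrdered p ∧
        ∀ l, tsupport (p l : EuclideanSpace ℝ (Fin 4) → ℝ) ⊆ {x | |x i| ≤ ρ'} := by
  have hw := hasTemperateGrowth_bddWeight i ρ
  refine ⟨fun l => SchwartzMap.smulLeftCLM ℝ (fun y : EuclideanSpace ℝ (Fin 4) =>
      Real.smoothTransition (ρ + 1 - y i) * Real.smoothTransition (y i - -ρ + 1)) (f l), ρ + 1,
    fun x => ?_, ?_, fun l => ?_⟩
  · -- the pointwise tensor identity: the weights are products over the points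
    rw [cutLE_apply, cutGE_apply, hP x]
    simp only [ofRealTest_apply, SchwartzMap.smulLeftCLM_apply_apply hw, smul_eq_mul, wLE, wGE,
      Complex.ofReal_prod, Complex.ofReal_mul, Finset.prod_mul_distrib]
    ring
  · -- slab-ordered with the same slabs
    obtain ⟨lo, hi, hlo, hle, hord, hsupp⟩ := hf
    exact ⟨lo, hi, hlo, hle, hord, fun l =>
      ((SchwartzMap.tsupport_smulLeftCLM_subset _ (f l)).trans inter_subset_left).trans (hsupp l)⟩
  · -- bounded in the coordinate `i`
    exact ((SchwartzMap.tsupport_smulLeftCLM_subset _ (f l)).trans inter_subset_right).trans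
      (tsupport_bddWeight_subset i ρ)

/-! ### Removing the two-sided cut-off -/

/-- **The two-sided coordinate cut-offs converge to the identity**: `cutLE crd ρ (cutGE crd (-ρ) F) → F`
in `𝓢` as `ρ → +∞` (write `cutLE ρ (cutGE (-ρ) F) = cutLE ρ (cutGE (-ρ) F - F) + cutLE ρ F`; the
first term tends to `0` by the `θ`-uniform seminorm bounds of `cutLE` and `cutGE (-ρ) F → F`, the
second to `F`) (Hörmander, ALPDO I, Lemma 7.1.8; Osterwalder–Schrader 1973 §2). [folklore] -/
theorem tendsto_cutLE_cutGE_atTop {d p : ℕ} (crd : Fin d)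
    (F : 𝓢((Fin p → EuclideanSpace ℝ (Fin d)), ℂ)) :
    Tendsto (fun ρ : ℝ => cutLE crd ρ (cutGE crd (-ρ) F)) atTop (𝓝 F) := by
  have h1 : Tendsto (fun ρ : ℝ => cutGE crd (-ρ) F - F) atTop (𝓝 0) := by
    have h := ((tendsto_cutGE_atBot crd F).comp tendsto_neg_atTop_atBot).sub_const F
    rw [sub_self] at h
    exact h
  have h2 : Tendsto (fun ρ : ℝ => cutLE crd ρ (cutGE crd (-ρ) F - F)) atTop (𝓝 0) := by
    rw [(schwartz_withSeminorms ℂ (Fin p → EuclideanSpace ℝ (Fin d)) ℂ).tendsto_nhds]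
    rintro ⟨k, l⟩ ε hε
    obtain ⟨C, hC0, hC⟩ := exists_bound_seminorm_cutLE (p := p) crd k l
    rw [(schwartz_withSeminorms ℂ (Fin p → EuclideanSpace ℝ (Fin d)) ℂ).tendsto_nhds'] at h1
    filter_upwards [h1 (Finset.Iic (k, l)) (ε / (C + 1)) (by positivity)] with ρ hρ
    rw [sub_zero] at hρ ⊢
    rw [SchwartzMap.schwartzSeminormFamily_apply]
    calc SchwartzMap.seminorm ℂ k l (cutLE crd ρ (cutGE crd (-ρ) F - F))
        ≤ C * (Finset.Iic (k, l)).sup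
            (schwartzSeminormFamily ℂ (Fin p → EuclideanSpace ℝ (Fin d)) ℂ) (cutGE crd (-ρ) F - F) :=
          hC ρ _
      _ ≤ C * (ε / (C + 1)) := mul_le_mul_of_nonneg_left hρ.le hC0
      _ < ε := by
          rw [mul_div_assoc', div_lt_iff₀ (by positivity)]
          nlinarith
  have h3 := h2.add (tendsto_cutLE_atTop crd F)
  rw [zero_add] at h3
  exact Tendsto.congr (fun ρ => by rw [map_sub, sub_add_cancel]) h3

/-! ### The density statement -/

/-- `stub_bddSlabDensity` — **ordered-wedge density with `xⁱ`-bounded factors** (reshape 15 glue): every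
time-ordered `F` lies in the closure of the `ℂ`-span of the real product tensors whose factor data are slab-ordered
(`IsSlabOrdered`) AND supported in a bounded range of the coordinate `i`. Route: the tree's ordered-wedge density
`IsTimeOrdered.mem_closure_span_slabOrderedProducts` puts `F` in the closure of the span of ALL slab-ordered real
product tensors; each such `P = ⊗ₗ pₗ` is the limit of its coordinate cut-offs `cutLE i ρ (cutGE i (−ρ) P)` as
`ρ → ∞` (`tendsto_cutLE_cutGE_atTop`), and the cut-off is again a real product tensor, of the factors multiplied by
the one-point smooth steps `σ(ρ + 1 − xⁱ) σ(xⁱ + ρ + 1)` (`exists_bdd_factors_cutLE_cutGE`), whose supports lie in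
`supp pₗ ∩ {|xⁱ| ≤ ρ + 1}` — still slab-ordered (Osterwalder–Schrader 1973 §2). [folklore] -/
theorem stub_bddSlabDensity :
    ∀ (n : ℕ) (i : Fin 4) (F : SchwartzMap (Fin n → EuclideanSpace ℝ (Fin 4)) ℂ), IsTimeOrdered F →
      F ∈ closure ((Submodule.span ℂ {P : SchwartzMap (Fin n → EuclideanSpace ℝ (Fin 4)) ℂ |
          ∃ (p : Fin n → SchwartzMap (EuclideanSpace ℝ (Fin 4)) ℝ) (ρ : ℝ),
            IsTensorOf P (fun l => ofRealTest (p l)) ∧ IsSlabOrdered p ∧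
              ∀ l, tsupport (p l : EuclideanSpace ℝ (Fin 4) → ℝ) ⊆ {x | |x i| ≤ ρ}} :
        Submodule ℂ (SchwartzMap (Fin n → EuclideanSpace ℝ (Fin 4)) ℂ)) :
        Set (SchwartzMap (Fin n → EuclideanSpace ℝ (Fin 4)) ℂ)) := by
  intro n i F hF
  set M : Submodule ℂ (SchwartzMap (Fin n → EuclideanSpace ℝ (Fin 4)) ℂ) :=
    Submodule.span ℂ {P : SchwartzMap (Fin n → EuclideanSpace ℝ (Fin 4)) ℂ |
      ∃ (p : Fin n → SchwartzMap (EuclideanSpace ℝ (Fin 4)) ℝ) (ρ : ℝ),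
        IsTensorOf P (fun l => ofRealTest (p l)) ∧ IsSlabOrdered p ∧
          ∀ l, tsupport (p l : EuclideanSpace ℝ (Fin 4) → ℝ) ⊆ {x | |x i| ≤ ρ}} with hM
  -- every slab-ordered real product tensor is a limit of bounded ones
  have hsub : slabOrderedProducts 4 n ⊆ closure (M : Set (SchwartzMap (Fin n → EuclideanSpace ℝ (Fin 4)) ℂ)) := by
    rintro P ⟨f, lo, hi, hP, hlo, hle, hord, hsupp⟩
    refine mem_closure_of_tendsto (tendsto_cutLE_cutGE_atTop i P)
      (Eventually.of_forall fun ρ => Submodule.subset_span ?_)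
    exact exists_bdd_factors_cutLE_cutGE i ρ hP ⟨lo, hi, hlo, hle, hord, hsupp⟩
  -- hence the closed span of all slab-ordered real product tensors is contained in `closure M`
  have hle : Submodule.span ℂ (slabOrderedProducts 4 n) ≤ M.topologicalClosure :=
    Submodule.span_le.2 hsub
  exact closure_minimal (SetLike.coe_subset_coe.2 hle) isClosed_closure
    hF.mem_closure_span_slabOrderedProducts

end Summit.QuantumFields.YangMills.Theorems.ContinuumLegGivenGap

end
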